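import Mathlib
import Summits.Schanuel.Schanuel.Theorems.RigidCoreMinimalCounterexampleInAclLogSector
import Summits.Schanuel.Schanuel.Theorems.RigidCoreMinimalCounterexampleInAclOfSparsityTwo
import Literature.NumberTheory.Transcendental.TrdegZariskiDimConverse
import Literature.NumberTheory.Transcendental.ExpPointsLogTypePole
import Literature.NumberTheory.Transcendental.ExpPointsCuspTranscendence
import Literature.NumberTheory.Transcendental.ExpPointsConstantExponential
import Literature.NumberTheory.Transcendental.ExpPointsDegenerateSections
import Literature.NumberTheory.Transcendental.ExpPointsBranchLaurent
import Literature.Analysis.Complex.BranchOrders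

/-!
# Window recurrence is finite when `e^{x₀}` is algebraic — line `kernel-arithmetic-selection`, crux stmt-Schanuel-0969

Route `RigidCore`, crux (S*) `MinimalCounterexampleInAcl`, lead prover-line-stmt-Schanuel-0969-c3-0, registered stub
`stub_windowRecurrence_e0` (`--supports stmt-Schanuel-0969`).

For an off-log rank-2 first failure `x` with `e^{x₀} ∈ ℚ̄` the set `E = {x'₀ : x' ∈ locusMates x}` lies on finitely many
cosets of `2πiℤ`; this file proves that LONG WINDOWS RECUR FINITELY OFTEN in `E`: there is `L` such that for every finite
`G ⊆ ℤ` with `|G| ≥ L` only finitely many `s` have `s + 2πig ∈ E` for all `g ∈ G`.  Structure: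

* `branch_window_finite` — ON ONE BRANCH AT INFINITY `𝔟(t) = ((t⁻ᵉ, Φ₁ t/tᴺ), (Φ₂ t/tᴺ, Φ₃ t/tᴺ)) ⊆ W` of the ℚ-curve
  `W ∋ (x, eˣ)` over one coset `c + 2πiℤ` (hits at the principal root `t = x₀^{−1/e}`): if the branch carries infinitely
  many coset hits then `y₀ ≡ eᶜ` on it, a log-type `y₁` is impossible (`false_of_logType_pole`), so `y₁ = e^{ℓ₁(t)}` and the
  hits are the `k` with `M(t_k) ∈ 2πiℤ` for the MEROMORPHIC phase `M = x₁ − ℓ₁`; if `M` were a polynomial in `t⁻ᵉ = x₀`,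
  `e^{ℓ₁}` and `ℓ₁` would both be algebraic over `ℂ[x̂₀]` (`isAlgebraic_coords_of_branch`), forcing `ℓ₁` constant
  (`eventually_const_of_isAlgebraic_exp`) and infinitely many independent points in one fibre `eˣ = ω`
  (`finite_indepExpPoints_fibre`) — so `M` is non-degenerate and the COSET WINDOW RIGIDITY (registered stub
  `stub_windowRigidity_coset`, taken as a hypothesis here) bounds the recurrences;
* `windowRecurrence_e0_of` — the assembly over the finitely many cosets (`exp '' E` finite) and the finitely many branches
  covering the large coset hits (registered stub `stub_cosetBranchCover`, taken as a hypothesis), with a pigeonhole from a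
  long window to a long same-branch sub-window;
* `stub_windowRecurrence_e0` — the registered form, from the two stubs once landed.

References: card `Cruxes/MinimalCounterexampleInAcl/Ideas/torsor-self-selection.md` (crux-ideate r1, ideator 2); the tree's
cusp machinery `Literature/NumberTheory/Transcendental/ExpPoints*.lean` (line cusp-germ-schneider-sparsity of crux 0971).
-/

noncomputable section

set_option linter.dupNamespace false

open Complex Filter Topology Set Metric Polynomial

namespace Summit.Schanuel.Schanuel.Cruxes.MinimalCounterexampleInAcl.KernelArithmeticSelection

open Literature.NumberTheory.Transcendental
open Literature.Analysis.Complex.LaurentGerm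
open Literature.Analysis.Complex.MeromorphicGerm (analyticAt_pow_succ_mul_div_pow analyticAt_pow_succ_mul_inv_pow)
open Literature.Analysis.Complex.BranchOrders (exists_zpow_exp_form)
open Summit.Schanuel.Schanuel.Theorems (mem_of_isDefinedOver_bot_of_relations)

/-- The Taylor series of `f : ℂ → ℂ` at `0`, as a formal power series (local notation, as in the tree's cusp files). -/
local notation3 "𝓣[" f "]" =>
  (PowerSeries.mk fun n => ((Nat.factorial n : ℂ)⁻¹ * iteratedDeriv n f 0) : PowerSeries ℂ)

/-- The Laurent expansion at `0` of a germ `f` with `zⁿ f(z)` analytic at `0` (local notation). -/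
local notation3 "𝓛[" n ", " f "]" =>
  (HahnSeries.single (-((n : ℕ) : ℤ)) (1 : ℂ) *
    HahnSeries.ofPowerSeries ℤ ℂ 𝓣[fun z : ℂ => z ^ (n : ℕ) * (f : ℂ → ℂ) z] : LaurentSeries ℂ)

/-- The branch point `((t⁻ᵉ, Φ₁ t / tᴺ), (Φ₂ t / tᴺ, Φ₃ t / tᴺ)) ∈ ℂ² × ℂ²` (local notation). -/
local notation3 "𝔟[" e ", " N ", " Φ₁ ", " Φ₂ ", " Φ₃ ", " t "]" =>
  (Sum.elim ![((t : ℂ) ^ (e : ℕ))⁻¹, (Φ₁ : ℂ → ℂ) t / t ^ (N : ℕ)]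
    ![(Φ₂ : ℂ → ℂ) t / t ^ (N : ℕ), (Φ₃ : ℂ → ℂ) t / t ^ (N : ℕ)] : Fin 2 ⊕ Fin 2 → ℂ)

/-! ## Facts at a hit on a branch -/

section Branch

variable {W : Set (Fin 2 ⊕ Fin 2 → ℂ)} {e N : ℕ} {Φ₁ Φ₂ Φ₃ : ℂ → ℂ}

/-- Coordinates of a point on the branch. [folklore] -/
theorem coords_of_eq_branch {x : Fin 2 → ℂ} {t : ℂ} (h : Sum.elim x (cexp ∘ x) = 𝔟[e, N, Φ₁, Φ₂, Φ₃, t]) :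
    x 0 = (t ^ e)⁻¹ ∧ x 1 = Φ₁ t / t ^ N ∧ cexp (x 0) = Φ₂ t / t ^ N ∧ cexp (x 1) = Φ₃ t / t ^ N := by
  refine ⟨?_, ?_, ?_, ?_⟩
  · have := congrFun h (Sum.inl 0); simpa using this
  · have := congrFun h (Sum.inl 1); simpa using this
  · have := congrFun h (Sum.inr 0); simpa using this
  · have := congrFun h (Sum.inr 1); simpa using this

/-- A small parameter from a large first coordinate: `‖t‖ < δ` once `δ⁻¹ ^ e < ‖(t ^ e)⁻¹‖`. [folklore] -/
theorem norm_lt_of_inv_pow {t : ℂ} {δ : ℝ} (hδ : 0 < δ) (ht : t ≠ 0)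
    (h : δ⁻¹ ^ e < ‖(t ^ e)⁻¹‖) : ‖t‖ < δ := by
  rw [norm_inv, norm_pow, inv_pow] at h
  have hpos : 0 < ‖t‖ ^ e := pow_pos (norm_pos_iff.2 ht) e
  have h1 : ‖t‖ ^ e < δ ^ e := (inv_lt_inv₀ (pow_pos hδ e) hpos).1 h
  exact lt_of_pow_lt_pow_left₀ e hδ.le h1

end Branch


/-- Finitely many integers `m` have `‖c + 2πi m‖ ≤ B`. [folklore] -/
theorem finite_int_norm_coset_le (c : ℂ) (B : ℝ) :
    Set.Finite {m : ℤ | ‖c + 2 * ↑Real.pi * I * (m : ℂ)‖ ≤ B} := by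
  set K : ℝ := (B + ‖c‖) / (2 * Real.pi) with hK
  refine (Set.finite_Icc (⌊-K⌋) (⌈K⌉)).subset ?_
  intro m hm
  simp only [Set.mem_setOf_eq] at hm
  have h2π : 0 < 2 * Real.pi := by positivity
  have hnorm : ‖(2 * ↑Real.pi * I * (m : ℂ) : ℂ)‖ = 2 * Real.pi * |(m : ℝ)| := by
    rw [norm_mul, norm_mul, norm_mul, Complex.norm_I, Complex.norm_intCast, Complex.norm_real,
      Complex.norm_ofNat, Real.norm_eq_abs, abs_of_pos Real.pi_pos, mul_one]
  have hle : 2 * Real.pi * |(m : ℝ)| ≤ B + ‖c‖ := by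
    rw [← hnorm]
    calc ‖(2 * ↑Real.pi * I * (m : ℂ) : ℂ)‖ = ‖(c + 2 * ↑Real.pi * I * (m : ℂ)) - c‖ := by ring_nf
      _ ≤ ‖c + 2 * ↑Real.pi * I * (m : ℂ)‖ + ‖c‖ := norm_sub_le _ _
      _ ≤ B + ‖c‖ := by linarith
  have habs : |(m : ℝ)| ≤ K := by
    rw [hK, le_div_iff₀ h2π]; linarith
  obtain ⟨h1, h2⟩ := abs_le.1 habs
  refine ⟨?_, ?_⟩
  · have h := Int.floor_le_floor h1
    rwa [Int.floor_intCast] at h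
  · have h := Int.ceil_le_ceil h2
    rwa [Int.ceil_intCast] at h

section BranchPhase

variable {W : Set (Fin 2 ⊕ Fin 2 → ℂ)} {e N : ℕ} {Φ₁ Φ₂ Φ₃ : ℂ → ℂ}

/-- **The phase of a branch carrying infinitely many coset hits is a non-degenerate meromorphic germ.**  On a branch at
infinity `𝔟 ⊆ W` of a ℚ-curve `W` of dimension `< 2` whose coset hits (first coordinate in `c + 2πiℤ`) accumulate at `t = 0`:
`y₀ ≡ eᶜ`, `y₁` is not log-type (`false_of_logType_pole`), so `y₁ = e^{ℓ₁(t)}` with `ℓ₁` analytic, and the phase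
`M = x₁ − ℓ₁` is meromorphic and NOT a polynomial in `t⁻ᵉ = x₀` (else `ℓ₁` and `e^{ℓ₁}` are algebraic over `ℂ[x̂₀]` by
`isAlgebraic_coords_of_branch`, `ℓ₁` is constant by `eventually_const_of_isAlgebraic_exp`, and a fibre `eˣ = ω` carries
infinitely many independent points, against `finite_indepExpPoints_fibre`). [folklore] -/
theorem branch_phase_nondegenerate
    (hW : IsDefinedOver (⊥ : Subfield ℂ) W) (hdim : zariskiDim ℂ W < 2) (he : 0 < e) {r : ℝ} (hr : 0 < r)
    (hana : ∀ t : ℂ, ‖t‖ < r → AnalyticAt ℂ Φ₁ t ∧ AnalyticAt ℂ Φ₂ t ∧ AnalyticAt ℂ Φ₃ t)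
    (hWb : ∀ t : ℂ, 0 < ‖t‖ → ‖t‖ < r → 𝔟[e, N, Φ₁, Φ₂, Φ₃, t] ∈ W) (c : ℂ)
    (hhitc : ∀ δ : ℝ, 0 < δ → Set.Infinite {x | x ∈ indepExpPoints W ∧
      (∃ m : ℤ, x 0 = c + 2 * ↑Real.pi * I * (m : ℂ)) ∧
      ∃ t : ℂ, 0 < ‖t‖ ∧ ‖t‖ < δ ∧ Sum.elim x (cexp ∘ x) = 𝔟[e, N, Φ₁, Φ₂, Φ₃, t]}) :
    ∃ ℓ₁ : ℂ → ℂ, AnalyticAt ℂ ℓ₁ 0 ∧ (∀ᶠ t in 𝓝[≠] (0 : ℂ), Φ₃ t / t ^ N = cexp (ℓ₁ t)) ∧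
      AnalyticAt ℂ (fun t : ℂ => t ^ (N + 1) * (Φ₁ t / t ^ N - ℓ₁ t)) 0 ∧
      ¬ ∃ Q : Polynomial ℂ, ∀ᶠ t in 𝓝[≠] (0 : ℂ), Φ₁ t / t ^ N - ℓ₁ t = Q.eval (t ^ e)⁻¹ := by
  classical
  obtain ⟨hΦ₁, hΦ₂, hΦ₃⟩ := hana 0 (by rw [norm_zero]; exact hr)
  have hhit : ∀ δ : ℝ, 0 < δ → Set.Infinite {x | x ∈ indepExpPoints W ∧ ∃ t : ℂ, 0 < ‖t‖ ∧
      ‖t‖ < δ ∧ Sum.elim x (cexp ∘ x) = 𝔟[e, N, Φ₁, Φ₂, Φ₃, t]} :=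
    fun δ hδ => (hhitc δ hδ).mono fun x hx => ⟨hx.1, hx.2.2⟩
  have hfreq : ∀ {P : ℂ → Prop}, (∀ (x : Fin 2 → ℂ) (t : ℂ), x ∈ indepExpPoints W → 0 < ‖t‖ → ‖t‖ < r →
      Sum.elim x (cexp ∘ x) = 𝔟[e, N, Φ₁, Φ₂, Φ₃, t] → (∃ m : ℤ, x 0 = c + 2 * ↑Real.pi * I * (m : ℂ)) → P t) →
      ∃ᶠ t in 𝓝[≠] (0 : ℂ), P t := by
    intro P hP
    refine Literature.Analysis.Complex.MeromorphicGerm.frequently_nhdsNE_of_forall_exists fun ε hε => ?_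
    obtain ⟨x, hxI, hm, t, ht0, htε, hxt⟩ := (hhitc (min ε r) (lt_min hε hr)).nonempty
    exact ⟨t, ht0, htε.trans_le (min_le_left _ _),
      hP x t hxI ht0 (htε.trans_le (min_le_right _ _)) hxt hm⟩
  -- the branch is eventually in `W`
  have hWev : ∀ᶠ t in 𝓝[≠] (0 : ℂ), 𝔟[e, N, Φ₁, Φ₂, Φ₃, t] ∈ W := by
    have hball : ∀ᶠ t in 𝓝[≠] (0 : ℂ), ‖t‖ < r :=
      eventually_nhdsWithin_of_eventually_nhds
        (eventually_norm_sub_lt 0 hr |>.mono fun t ht => by simpa using ht)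
    filter_upwards [hball, self_mem_nhdsWithin] with t ht ht0
    have htne : t ≠ 0 := by rintro rfl; exact ht0 (Set.mem_singleton 0)
    exact hWb t (norm_pos_iff.2 htne) ht
  -- (B2) `y₀ ≡ eᶜ` on the branch
  have hy₀ev : ∀ᶠ t in 𝓝[≠] (0 : ℂ), Φ₂ t / t ^ N = t ^ (0 : ℤ) * cexp ((fun _ : ℂ => c) t) := by
    set F : ℂ → ℂ := fun t => Φ₂ t - cexp c * t ^ N with hF
    have hFan : AnalyticAt ℂ F 0 := hΦ₂.sub (analyticAt_const.mul (analyticAt_id.pow N))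
    have hFfreq : ∃ᶠ t in 𝓝[≠] (0 : ℂ), F t = 0 := by
      refine hfreq fun x t _ ht0 _ hxt hm => ?_
      obtain ⟨m, hm⟩ := hm
      obtain ⟨-, -, h2, -⟩ := coords_of_eq_branch hxt
      have htne : t ≠ 0 := norm_pos_iff.1 ht0
      have hexp0 : cexp (x 0) = cexp c := by
        rw [hm, Complex.exp_add, mul_comm (2 * ↑Real.pi * I) (m : ℂ), Complex.exp_int_mul_two_pi_mul_I, mul_one]
      rw [hF]
      show Φ₂ t - cexp c * t ^ N = 0
      have h' : cexp c = Φ₂ t / t ^ N := hexp0.symm.trans h2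
      rw [h', div_mul_cancel₀ _ (pow_ne_zero N htne), sub_self]
    have hFev : ∀ᶠ t in 𝓝 (0 : ℂ), F t = 0 := hFan.frequently_zero_iff_eventually_zero.1 hFfreq
    filter_upwards [eventually_nhdsWithin_of_eventually_nhds hFev, self_mem_nhdsWithin] with t ht ht0
    have htne : t ≠ 0 := by rintro rfl; exact ht0 (Set.mem_singleton 0)
    rw [zpow_zero, one_mul]
    rw [hF] at ht
    have : Φ₂ t = cexp c * t ^ N := sub_eq_zero.1 ht
    rw [this]
    field_simp
  -- (B3) the multiplicative form of `y₁`
  have hne₃ : ∃ᶠ t in 𝓝[≠] (0 : ℂ), Φ₃ t ≠ 0 := by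
    refine hfreq fun x t _ _ _ hxt _ h0 => ?_
    obtain ⟨-, -, -, h3⟩ := coords_of_eq_branch hxt
    rw [h0, zero_div] at h3
    exact Complex.exp_ne_zero _ h3
  obtain ⟨μ₁, -, -, ℓ₁, -, -, hℓ₁, -, -, -, hy₁⟩ := exists_zpow_exp_form hΦ₃ hne₃ N
  -- (B4) `y₁` is not log-type: `μ₁ = 0`
  have hμ₁ : μ₁ = 0 := by
    by_contra hμ
    refine false_of_logType_pole (W := W) (e := e) (N := N) (Φ₂ := Φ₂) hΦ₁ hhit (μ₀ := 0)
      (ℓ₀ := fun _ : ℂ => c) analyticAt_const hℓ₁ hy₀ev hy₁ (Or.inr hμ) ?_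
    rintro ⟨Φh, hΦh, hev⟩
    -- `(t^e)⁻¹` would be bounded near `0`
    have hcont : ContinuousAt Φh 0 := hΦh.continuousAt
    obtain ⟨δ₁, hδ₁, hB⟩ : ∃ δ₁ > 0, ∀ t : ℂ, ‖t‖ < δ₁ → ‖Φh t‖ < ‖Φh 0‖ + 1 := by
      have h := Metric.continuousAt_iff.1 hcont 1 one_pos
      obtain ⟨δ₁, hδ₁, h⟩ := h
      refine ⟨δ₁, hδ₁, fun t ht => ?_⟩
      have := h (by simpa [dist_eq_norm] using ht)
      rw [dist_eq_norm] at this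
      calc ‖Φh t‖ = ‖(Φh t - Φh 0) + Φh 0‖ := by ring_nf
        _ ≤ ‖Φh t - Φh 0‖ + ‖Φh 0‖ := norm_add_le _ _
        _ < ‖Φh 0‖ + 1 := by linarith
    obtain ⟨δ₂, hδ₂, hev'⟩ := exists_radius_of_eventually hev
    -- choose a small positive real `t`
    set Bd : ℝ := (‖Φh 0‖ + 1) / ‖(μ₁ : ℂ)‖ + ‖c‖ + 1 with hBd
    have hμne : (μ₁ : ℂ) ≠ 0 := by exact_mod_cast hμ
    have hμpos : 0 < ‖(μ₁ : ℂ)‖ := norm_pos_iff.2 hμne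
    have hBdpos : 0 < Bd := by rw [hBd]; positivity
    set τ : ℝ := min (min δ₁ δ₂) (Bd⁻¹ ^ ((e : ℝ)⁻¹)) / 2 with hτ
    have hmpos : 0 < min (min δ₁ δ₂) (Bd⁻¹ ^ ((e : ℝ)⁻¹)) :=
      lt_min (lt_min hδ₁ hδ₂) (Real.rpow_pos_of_pos (inv_pos.2 hBdpos) _)
    have hτpos : 0 < τ := by rw [hτ]; linarith
    have hτlt : τ < min (min δ₁ δ₂) (Bd⁻¹ ^ ((e : ℝ)⁻¹)) := by rw [hτ]; linarith
    have hτδ₁ : τ < δ₁ := hτlt.trans_le ((min_le_left _ _).trans (min_le_left _ _))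
    have hτδ₂ : τ < δ₂ := hτlt.trans_le ((min_le_left _ _).trans (min_le_right _ _))
    have hτB : τ < Bd⁻¹ ^ ((e : ℝ)⁻¹) := hτlt.trans_le (min_le_right _ _)
    set t : ℂ := (τ : ℂ) with ht
    have htnorm : ‖t‖ = τ := by rw [ht, Complex.norm_real, Real.norm_eq_abs, abs_of_pos hτpos]
    have ht0 : 0 < ‖t‖ := by rw [htnorm]; exact hτpos
    have hid := hev' t ht0 (by rw [htnorm]; exact hτδ₂)
    simp only [Int.cast_zero, zero_mul, sub_zero] at hid
    -- `μ₁ ((t^e)⁻¹ - c) = Φh t`, so `‖(t^e)⁻¹‖ ≤ ‖Φh t‖/‖μ₁‖ + ‖c‖ < Bd`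
    have hinv : (t ^ e)⁻¹ = Φh t / (μ₁ : ℂ) + c := by
      field_simp
      linear_combination hid
    have hle : ‖(t ^ e)⁻¹‖ < Bd := by
      rw [hinv]
      calc ‖Φh t / (μ₁ : ℂ) + c‖ ≤ ‖Φh t / (μ₁ : ℂ)‖ + ‖c‖ := norm_add_le _ _
        _ = ‖Φh t‖ / ‖(μ₁ : ℂ)‖ + ‖c‖ := by rw [norm_div]
        _ < (‖Φh 0‖ + 1) / ‖(μ₁ : ℂ)‖ + ‖c‖ + 1 := by
            have := hB t (by rw [htnorm]; exact hτδ₁)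
            have h2 : ‖Φh t‖ / ‖(μ₁ : ℂ)‖ ≤ (‖Φh 0‖ + 1) / ‖(μ₁ : ℂ)‖ :=
              div_le_div_of_nonneg_right this.le hμpos.le
            linarith
    -- but `‖(t^e)⁻¹‖ = τ^{-e} > Bd`
    have hge : Bd < ‖(t ^ e)⁻¹‖ := by
      rw [norm_inv, norm_pow, htnorm]
      have hτe : τ ^ e < (Bd⁻¹ ^ ((e : ℝ)⁻¹)) ^ e := pow_lt_pow_left₀ hτB hτpos.le he.ne'
      have heq : (Bd⁻¹ ^ ((e : ℝ)⁻¹)) ^ e = Bd⁻¹ := by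
        rw [← Real.rpow_natCast, ← Real.rpow_mul (inv_nonneg.2 hBdpos.le), inv_mul_cancel₀ (by exact_mod_cast he.ne'),
          Real.rpow_one]
      rw [heq] at hτe
      have := (inv_lt_inv₀ (inv_pos.2 hBdpos) (pow_pos hτpos e)).2 hτe
      rwa [inv_inv] at this
    exact absurd (hle.trans hge) (lt_irrefl _)
  subst hμ₁
  simp only [zpow_zero, one_mul] at hy₁
  -- (B5) the meromorphic phase `M = x₁ − ℓ₁(t)`
  set M : ℂ → ℂ := fun t => Φ₁ t / t ^ N - ℓ₁ t with hM
  have raise : ∀ {f : ℂ → ℂ} {n K : ℕ}, AnalyticAt ℂ (fun t : ℂ => t ^ n * f t) 0 → n ≤ K →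
      AnalyticAt ℂ (fun t : ℂ => t ^ K * f t) 0 := by
    intro f n K hf hle
    obtain ⟨k, rfl⟩ := Nat.exists_eq_add_of_le hle
    exact analyticAt_pow_add hf k
  have hf₁ : AnalyticAt ℂ (fun t : ℂ => t ^ (N + 1) * (Φ₁ t / t ^ N)) 0 := analyticAt_pow_succ_mul_div_pow hΦ₁ N
  have hℓK : AnalyticAt ℂ (fun t : ℂ => t ^ (N + 1) * ℓ₁ t) 0 :=
    raise (f := ℓ₁) (n := 0) (by simpa using hℓ₁) (Nat.zero_le _)
  have hMan : AnalyticAt ℂ (fun t : ℂ => t ^ (N + 1) * M t) 0 := by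
    have hneg : AnalyticAt ℂ (fun t : ℂ => t ^ (N + 1) * (-ℓ₁ t)) 0 := by
      simpa using analyticAt_const_mul hℓK (-1)
    simpa [hM, sub_eq_add_neg] using analyticAt_add hf₁ hneg
  -- (B6) `M` is not a polynomial in `(t^e)⁻¹`
  have hndeg : ¬ ∃ Q : Polynomial ℂ, ∀ᶠ t in 𝓝[≠] (0 : ℂ), M t = Q.eval (t ^ e)⁻¹ := by
    rintro ⟨Q, hQ⟩
    have req : ∀ {f : ℂ → ℂ} {n K : ℕ} (hf : AnalyticAt ℂ (fun t : ℂ => t ^ n * f t) 0) (hle : n ≤ K),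
        𝓛[K, f] = 𝓛[n, f] := fun hf hle => laurent_eq_of_analyticAt (raise hf hle) hf
    have hf₀ : AnalyticAt ℂ (fun t : ℂ => t ^ (e + 1) * (t ^ e)⁻¹) 0 := analyticAt_pow_succ_mul_inv_pow e
    have hg₀ : AnalyticAt ℂ (fun t : ℂ => t ^ (N + 1) * (Φ₂ t / t ^ N)) 0 := analyticAt_pow_succ_mul_div_pow hΦ₂ N
    have hg₁ : AnalyticAt ℂ (fun t : ℂ => t ^ (N + 1) * (Φ₃ t / t ^ N)) 0 := analyticAt_pow_succ_mul_div_pow hΦ₃ N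
    have hx₀ : 𝓛[e + 1, fun t : ℂ => (t ^ e)⁻¹] = HahnSeries.single (-(e : ℤ)) (1 : ℂ) := (laurent_inv_pow e).1
    have htr₀ : Transcendental ℂ 𝓛[e + 1, fun t : ℂ => (t ^ e)⁻¹] := by
      rw [hx₀]
      refine transcendental_of_coeff_ne_zero (n := -(e : ℤ)) (by omega) ?_
      rw [HahnSeries.coeff_single_same]; exact one_ne_zero
    obtain ⟨ha₁, -, ha₃⟩ := isAlgebraic_coords_of_branch hdim hf₀ hf₁ hg₀ hg₁ hWev htr₀
    set a : LaurentSeries ℂ := 𝓛[e + 1, fun t : ℂ => (t ^ e)⁻¹] with ha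
    set R' := Algebra.adjoin ℂ ({a} : Set (LaurentSeries ℂ)) with hR'
    -- the Laurent expansion of `Q((t^e)⁻¹)` lies in `R'`
    set P : MvPolynomial (Fin 2) ℂ := Polynomial.aeval (MvPolynomial.X 0 : MvPolynomial (Fin 2) ℂ) Q with hP
    have hPeval : ∀ t : ℂ, MvPolynomial.eval ![(t ^ e)⁻¹, (t ^ e)⁻¹] P = Q.eval (t ^ e)⁻¹ := by
      intro t
      have h := Polynomial.aeval_algHom_apply (MvPolynomial.aeval ![(t ^ e)⁻¹, (t ^ e)⁻¹])
        (MvPolynomial.X 0 : MvPolynomial (Fin 2) ℂ) Q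
      rw [MvPolynomial.aeval_X, Matrix.cons_val_zero] at h
      have h2 : MvPolynomial.eval ![(t ^ e)⁻¹, (t ^ e)⁻¹] P = MvPolynomial.aeval ![(t ^ e)⁻¹, (t ^ e)⁻¹] P := by
        rw [← MvPolynomial.coe_aeval_eq_eval]; rfl
      rw [h2, hP, ← h, Polynomial.coe_aeval_eq_eval]
    set K₀ : ℕ := ((e + 1) + (e + 1)) * P.totalDegree with hK₀
    obtain ⟨hLQ, hQan⟩ := laurent_eval hf₀ hf₀ P (N := K₀) le_rfl
    have hrange : Set.range ![a, a] = {a} := by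
      ext z
      simp only [Set.mem_range, Set.mem_singleton_iff]
      constructor
      · rintro ⟨i, rfl⟩; fin_cases i <;> rfl
      · rintro rfl; exact ⟨0, rfl⟩
    have hQmem : (MvPolynomial.aeval ![a, a] P : LaurentSeries ℂ) ∈ R' := by
      rw [hR', ← hrange, Algebra.adjoin_range_eq_range_aeval]
      exact ⟨P, rfl⟩
    have hQalg : IsAlgebraic R' (MvPolynomial.aeval ![a, a] P : LaurentSeries ℂ) :=
      isAlgebraic_algebraMap (⟨_, hQmem⟩ : R')
    -- `ℓ₁ = x₁ − Q((t^e)⁻¹)` on a punctured neighbourhood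
    have hℓeq : ∀ᶠ t in 𝓝[≠] (0 : ℂ), ℓ₁ t = Φ₁ t / t ^ N - MvPolynomial.eval ![(t ^ e)⁻¹, (t ^ e)⁻¹] P := by
      filter_upwards [hQ] with t ht
      rw [hPeval, ← ht, hM]; ring
    -- the Laurent expansion of `ℓ₁` is algebraic over `ℂ[x̂₀]`
    set K : ℕ := (N + 1) + K₀ with hK
    have hf₁K : AnalyticAt ℂ (fun t : ℂ => t ^ K * (Φ₁ t / t ^ N)) 0 := raise hf₁ (Nat.le_add_right _ _)
    have hQK : AnalyticAt ℂ (fun t : ℂ => t ^ K * MvPolynomial.eval ![(t ^ e)⁻¹, (t ^ e)⁻¹] P) 0 :=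
      raise hQan (Nat.le_add_left _ _)
    have hℓ₁K : AnalyticAt ℂ (fun t : ℂ => t ^ K * ℓ₁ t) 0 :=
      raise (f := ℓ₁) (n := 0) (by simpa using hℓ₁) (Nat.zero_le _)
    have hdiffK : AnalyticAt ℂ
        (fun t : ℂ => t ^ K * (Φ₁ t / t ^ N - MvPolynomial.eval ![(t ^ e)⁻¹, (t ^ e)⁻¹] P)) 0 := by
      have hneg : AnalyticAt ℂ (fun t : ℂ => t ^ K * (-MvPolynomial.eval ![(t ^ e)⁻¹, (t ^ e)⁻¹] P)) 0 := by
        simpa using analyticAt_const_mul hQK (-1)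
      simpa [sub_eq_add_neg] using analyticAt_add hf₁K hneg
    have hℓhat : 𝓛[0, ℓ₁] = 𝓛[N + 1, fun t : ℂ => Φ₁ t / t ^ N] - MvPolynomial.aeval ![a, a] P := by
      have h1 : 𝓛[0, ℓ₁] = 𝓛[K, ℓ₁] := (req (f := ℓ₁) (n := 0) (by simpa using hℓ₁) (Nat.zero_le _)).symm
      have h2 := laurent_sub hf₁K hQK
      have h3 := laurent_congr hℓ₁K hdiffK hℓeq
      beta_reduce at h2 h3
      rw [h1, h3, h2, req hf₁ (Nat.le_add_right _ _), req hQan (Nat.le_add_left _ _), hLQ]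
    have h₁ : IsAlgebraic R' 𝓛[0, ℓ₁] := by
      rw [hℓhat]
      exact ha₁.sub hQalg
    -- the Laurent expansion of `e^{ℓ₁} = y₁` is algebraic over `ℂ[x̂₀]`
    have hexpan : AnalyticAt ℂ (fun t => cexp (ℓ₁ t)) 0 := analyticAt_cexp.comp hℓ₁
    have hEK : AnalyticAt ℂ (fun t : ℂ => t ^ (N + 1) * cexp (ℓ₁ t)) 0 :=
      raise (f := fun t => cexp (ℓ₁ t)) (n := 0) (by simpa using hexpan) (Nat.zero_le _)
    have hEeq : 𝓛[N + 1, fun t : ℂ => Φ₃ t / t ^ N] = 𝓛[N + 1, fun t : ℂ => cexp (ℓ₁ t)] :=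
      laurent_congr hg₁ hEK hy₁
    have h₂ : IsAlgebraic R' 𝓛[0, fun t => cexp (ℓ₁ t)] := by
      rw [← req (f := fun t => cexp (ℓ₁ t)) (n := 0) (K := N + 1) (by simpa using hexpan) (Nat.zero_le _), ← hEeq]
      exact ha₃
    have hconst : ∀ᶠ t in 𝓝 (0 : ℂ), ℓ₁ t = ℓ₁ 0 := eventually_const_of_isAlgebraic_exp hℓ₁ h₁ h₂
    -- hence infinitely many independent points in the fibre over `(eᶜ, e^{ℓ₁ 0})`
    obtain ⟨δ₃, hδ₃, hδ₃P⟩ := exists_radius_of_eventually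
      ((eventually_nhdsWithin_of_eventually_nhds hconst).and (hy₁.and hy₀ev))
    refine (finite_indepExpPoints_fibre W hW hdim ![cexp c, cexp (ℓ₁ 0)]).not_infinite ((hhit δ₃ hδ₃).mono ?_)
    rintro x ⟨hxI, t, ht0, htδ, hxt⟩
    obtain ⟨hc1, hc2, hc3⟩ := hδ₃P t ht0 htδ
    obtain ⟨-, -, h2, h3⟩ := coords_of_eq_branch hxt
    refine ⟨hxI, funext fun i => ?_⟩
    fin_cases i
    · show cexp (x 0) = cexp c
      rw [h2, hc3, zpow_zero, one_mul]
    · show cexp (x 1) = cexp (ℓ₁ 0)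
      rw [h3, hc2, hc1]
  exact ⟨ℓ₁, hℓ₁, hy₁, hMan, hndeg⟩

end BranchPhase

/-- **Registered stub `stub_branchPhaseNondegenerate` (PROVED)** — explicit-binder form of `branch_phase_nondegenerate`. [folklore] -/
theorem stub_branchPhaseNondegenerate : ∀ (W : Set (Fin 2 ⊕ Fin 2 → ℂ)) (e N : ℕ) (Φ₁ Φ₂ Φ₃ : ℂ → ℂ) (r : ℝ) (c : ℂ), Literature.NumberTheory.Transcendental.IsDefinedOver (⊥ : Subfield ℂ) W → Literature.NumberTheory.Transcendental.zariskiDim ℂ W < 2 → 0 < e → 0 < r → (∀ t : ℂ, ‖t‖ < r → AnalyticAt ℂ Φ₁ t ∧ AnalyticAt ℂ Φ₂ t ∧ AnalyticAt ℂ Φ₃ t) → (∀ t : ℂ, 0 < ‖t‖ → ‖t‖ < r → (Sum.elim ![(t ^ e)⁻¹, Φ₁ t / t ^ N] ![Φ₂ t / t ^ N, Φ₃ t / t ^ N] : Fin 2 ⊕ Fin 2 → ℂ) ∈ W) → (∀ δ : ℝ, 0 < δ → Set.Infinite {x : Fin 2 → ℂ | x ∈ Literature.NumberTheory.Transcendental.indepExpPoints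 W ∧ (∃ m : ℤ, x 0 = c + 2 * ↑Real.pi * Complex.I * (m : ℂ)) ∧ ∃ t : ℂ, 0 < ‖t‖ ∧ ‖t‖ < δ ∧ Sum.elim x (Complex.exp ∘ x) = (Sum.elim ![(t ^ e)⁻¹, Φ₁ t / t ^ N] ![Φ₂ t / t ^ N, Φ₃ t / t ^ N] : Fin 2 ⊕ Fin 2 → ℂ)}) → ∃ ℓ₁ : ℂ → ℂ, AnalyticAt ℂ ℓ₁ 0 ∧ (∀ᶠ t in 𝓝[≠] (0 : ℂ), Φ₃ t / t ^ N = Complex.exp (ℓ₁ t)) ∧ AnalyticAt ℂ (fun t : ℂ => t ^ (N + 1) * (Φ₁ t / t ^ N - ℓ₁ t)) 0 ∧ ¬ ∃ Q : Polynomial ℂ, ∀ᶠ t in 𝓝[≠] (0 : ℂ), Φ₁ t / t ^ N - ℓ₁ t = Q.eval (t ^ e)⁻¹ :=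
  fun _ _ _ _ _ _ _ c hW hdim he hr hana hWb hhitc => branch_phase_nondegenerate hW hdim he hr hana hWb c hhitc

end Summit.Schanuel.Schanuel.Cruxes.MinimalCounterexampleInAcl.KernelArithmeticSelection

end
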